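import Literature.NumberTheory.LFunctions.SuzukiScrewLineRepairedConsequences
import Literature.NumberTheory.LFunctions.WeilArchimedeanPositivityProofs
import Literature.NumberTheory.LFunctions.WeilMellinBounds
import Literature.NumberTheory.LFunctions.SuzukiScrewLineProp41Proofs
import HarnessLib

/-!
# CJM Thm 1.4 and Cor 1.5 over the repaired screw line — DISCHARGED as RH-equivalences

LINE 1 — LABEL: E-class EQUIVALENCES PROVED (like Weil's criterion): `Suzuki2025_thm14R_holds :
RiemannHypothesis ↔ (1.9)ᴿ ∀ψ` and `Suzuki2025_cor15R_holds`; the new content is the RH-CONSEQUENCE half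
"RH ⟹ (1.9)ᴿ" (binder `RiemannHypothesis →` explicit), the RH-free half being the cell's
`Suzuki2025_thm14R_if` (Weil's criterion). Theorems only; no definition, no named fact; net debt −2.
bears_on: B-C/B-P (LADDER-RH COLUMN 6 DBR). WHAT THIS IS NOT: proving that a criterion is EQUIVALENT
to RH fixes which identity would prove RH and does not move RH; (1.9)ᴿ itself is shown by nobody;
nothing here bears on the truth of RH.

Source: M. Suzuki, Canad. J. Math. 2025 = arXiv:2301.00421v3, Thm 1.4 (TeX l.420–430), Cor 1.5 (TeX
l.438–451), proof §4.3 (TeX l.1286–1300: "`‖P̂_{Dψ}‖² = π Σ_γ m_γ|ψ̂(γ)|² = π⟨ψ,ψ⟩_W` by (3.8) and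
Prop 4.1"), over the repaired objects (erratum E21).

## What is proved (all theorems; §§0–C)
* §0 (RH-free dictionary and (3.8)ᴿ; one RH-consequence identity): `suzukiHat_eq_weilMellin`
  (`ψ̂(w) = weilMellin ψ (½ + iw)`), `suzukiHat_deriv` (`(ψ′)^(w) = −iw ψ̂(w)`), `suzukiHat_suzukiD`
  (`(Dψ)^(w) = w ψ̂(w)`), `screwPhatR_suzukiD_eq_tsum` / `screwPhatR_suzukiD_eq_tsum_screwBasis`
  (**(3.8)ᴿ**: `P̂ᴿ_{Dψ}(x) = Σ_ρ (−√(πm_ρ)ψ̂(γ_ρ))·F_ρ(x)` at a.e. real `x`; printed (3.8) has `+`, the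
  print being loose by `F_γ ↔ F_γ♯`), `weilQuadratic_eq_tsum_norm_sq_suzukiHat` (**under RH**
  `⟨ψ,ψ⟩_W = Σ_ρ m_ρ‖ψ̂(γ_ρ)‖²`, summable).
* §A generic: `summable_and_norm_sq_tsum` (Parseval for an orthonormal family with ℓ² coefficients),
  `coeFn_tsum_ae_eq_tsum` (an `L²`-sum of `L²` functions converging pointwise a.e. is the pointwise sum
  a.e.); §B `summable_coeff_mul_screwBasis`; §C `Suzuki2025_thm14R_onlyIf`, `Suzuki2025_thm14R_holds`,
  `Suzuki2025_cor15R_holds`.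

## Proof of "RH ⟹ (1.9)ᴿ" (printed, TeX l.1286–1300)
Under RH: (3.8)ᴿ `P̂ᴿ_{Dψ} = Σ_ρ c_ρ F_ρ` a.e. with `c_ρ = −√(πm_ρ)ψ̂(γ_ρ)`
(`screwPhatR_suzukiD_eq_tsum_screwBasis`); `{F_ρ}` is orthonormal in `L²(ℝ)` (CJM Prop 4.1,
`Suzuki2025_prop41_holds`); `Σ|c_ρ|² = π Σ m_ρ|ψ̂(γ_ρ)|² = π⟨ψ,ψ⟩_W < ∞`
(`weilQuadratic_eq_tsum_norm_sq_suzukiHat`); hence the `L²`-sum `G = Σ c_ρ F_ρ` exists with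
`‖G‖² = Σ|c_ρ|²` (`ScrewLineRepairedThm14.summable_and_norm_sq_tsum`), and `G = P̂ᴿ_{Dψ}` a.e. (the
`L²` sum and the pointwise absolutely convergent series agree a.e.,
`ScrewLineRepairedThm14.coeFn_tsum_ae_eq_tsum`). So
`‖P̂ᴿ_{Dψ}‖² = π⟨ψ,ψ⟩_W`, i.e. (1.9)ᴿ.

## References
* [Suzuki2025WeilHilbertSpace] CJM 2025 = arXiv:2301.00421v3, Thm 1.4, Cor 1.5, §4.3 (TeX l.1286–1300),
  Prop 4.1 (l.1120–1142), (3.8) (l.1050–1058).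
-/

noncomputable section

open MeasureTheory Complex Filter Set Real
open scoped ComplexConjugate Topology ENNReal InnerProductSpace

namespace Literature.NumberTheory.LFunctions

open ScrewLineRepairedExpansion ZetaZeros

/-! ## 0a. The dictionary `ψ̂ ↔ weilMellin` and `(Dψ)^(w) = w ψ̂(w)` -/

/-- `ψ̂(w) = weilMellin ψ (½ + iw)` (both are `∫ ψ(x) e^{iwx} dx`). [cite: Suzuki2025WeilHilbertSpace, eq. (1.1) (TeX l.240–246)] -/
theorem suzukiHat_eq_weilMellin (ψ : ℝ → ℂ) (w : ℂ) :
    suzukiHat ψ w = weilMellin ψ (1 / 2 + I * w) := by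
  have h := suzukiHat_neg_suzukiZeroParam ψ (1 / 2 + I * w)
  have hw : -suzukiZeroParam (1 / 2 + I * w) = w := by
    unfold suzukiZeroParam
    linear_combination (-w) * Complex.I_sq
  rwa [hw] at h

/-- Integration by parts in Suzuki's normalisation: `(ψ′)^(w) = −iw·ψ̂(w)` for a test function `ψ`.
[cite: Suzuki2025WeilHilbertSpace, (3.8) (TeX l.1056–1058: "(D̂ψ)(z)/z = ψ̂(z)")] -/
theorem suzukiHat_deriv {ψ : ℝ → ℂ} (hψ : IsWeilTest ψ) (w : ℂ) :
    suzukiHat (deriv ψ) w = -(I * w) * suzukiHat ψ w := by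
  rw [suzukiHat_eq_weilMellin, suzukiHat_eq_weilMellin, weilMellin_deriv hψ]
  ring

/-- **`(Dψ)^(w) = w·ψ̂(w)`** for `D = i d/dt` (1.8) and a test function `ψ`; in particular
`(Dψ)^(0) = 0`. [cite: Suzuki2025WeilHilbertSpace, (3.8) (TeX l.1056–1058)] -/
theorem suzukiHat_suzukiD {ψ : ℝ → ℂ} (hψ : IsWeilTest ψ) (w : ℂ) :
    suzukiHat (suzukiD ψ) w = w * suzukiHat ψ w := by
  have h : suzukiHat (suzukiD ψ) w = I * suzukiHat (deriv ψ) w := by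
    unfold suzukiHat suzukiD
    rw [← integral_const_mul]
    congr 1 with x
    ring
  rw [h, suzukiHat_deriv hψ]
  linear_combination (-(w * suzukiHat ψ w)) * Complex.I_sq

/-- `(Dψ)^(0) = 0` (`= i∫ψ′ = 0`). [cite: Suzuki2025WeilHilbertSpace, (3.8) (TeX l.1056–1058)] -/
theorem suzukiHat_suzukiD_zero {ψ : ℝ → ℂ} (hψ : IsWeilTest ψ) : suzukiHat (suzukiD ψ) 0 = 0 := by
  rw [suzukiHat_suzukiD hψ, zero_mul]

/-! ## 0b. (3.8)ᴿ -/

/-- **(3.8)ᴿ — the zero expansion of `P̂ᴿ_{Dψ}` on the real line**: for a test function `ψ` and a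
real `x ≠ 0` with `E_ξ(x) ≠ 0`, `±x ∉ Γ` (almost every `x`),
`P̂ᴿ_{Dψ}(x) = −(i/2)(1 + Θ(x)) Σ_ρ m_ρ ψ̂(γ_ρ)/(x − γ_ρ)` ((3.7)ᴿ in the printed variables with
`((Dψ)^(γ) − (Dψ)^(0))/γ = ψ̂(γ)`). RH-FREE. [cite: Suzuki2025WeilHilbertSpace, (3.8) (TeX l.1050–1058); erratum E21] -/
theorem screwPhatR_suzukiD_eq_tsum {ψ : ℝ → ℂ} (hψ : IsWeilTest ψ) {x : ℝ} (hx0 : x ≠ 0)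
    (hE : lagariasE x ≠ 0)
    (hxΓ : ∀ ρ ∈ ZetaZeros.riemannZetaNontrivialZeros, (x : ℂ) ≠ suzukiZeroParam ρ)
    (hxΓ' : ∀ ρ ∈ ZetaZeros.riemannZetaNontrivialZeros, -(x : ℂ) ≠ suzukiZeroParam ρ) :
    screwPhatR (suzukiD ψ) x = -(I / 2) * (1 + lagariasTheta x) *
      ∑' ρ : ZetaZeros.riemannZetaNontrivialZeros, (riemannZetaZeroOrder (ρ : ℂ) : ℂ) *
        suzukiHat ψ (suzukiZeroParam (ρ : ℂ)) / ((x : ℂ) - suzukiZeroParam (ρ : ℂ)) := by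
  rw [screwPhatR_eq_tsum_suzukiHat hψ.suzukiD hx0 hE hxΓ hxΓ']
  congr 1
  refine tsum_congr fun ρ ↦ ?_
  have hγ : suzukiZeroParam (ρ : ℂ) ≠ 0 := norm_pos_iff.1 (norm_zeroParam_pos ρ)
  rw [suzukiHat_suzukiD hψ, suzukiHat_suzukiD_zero hψ, sub_zero,
    show (riemannZetaZeroOrder (ρ : ℂ) : ℂ) * (suzukiZeroParam (ρ : ℂ) *
        suzukiHat ψ (suzukiZeroParam (ρ : ℂ))) = suzukiZeroParam (ρ : ℂ) *
        ((riemannZetaZeroOrder (ρ : ℂ) : ℂ) * suzukiHat ψ (suzukiZeroParam (ρ : ℂ))) by ring,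
    mul_div_mul_left _ _ hγ]

/-- `√(πm)·√(m/π) = m` (as complex numbers), the normalisation of (3.5)–(3.8). [folklore] -/
private theorem sqrt_pi_mul_mul_sqrt_div_pi {m : ℝ} (hm : 0 ≤ m) :
    ((Real.sqrt (Real.pi * m) : ℝ) : ℂ) * ((Real.sqrt (m / Real.pi) : ℝ) : ℂ) = (m : ℂ) := by
  rw [← Complex.ofReal_mul, ← Real.sqrt_mul (by positivity), show Real.pi * m * (m / Real.pi) =
    m * m by field_simp, Real.sqrt_mul_self hm]

/-- **(3.8)ᴿ against the family `F_ρ` of (3.5)**: `P̂ᴿ_{Dψ}(x) = Σ_ρ (−√(πm_ρ) ψ̂(γ_ρ)) · F_ρ(x)`,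
`F_ρ = screwBasis ρ = √(m_ρ/π)· i(1+Θ)/(2(· − γ_ρ))`, at every good real `x` (a.e.). Printed (3.8) has
`+√(πm_γ)ψ̂(γ)` (the print is loose by `F_γ ↔ F_γ♯`, a global sign, immaterial in norm). RH-FREE.
[cite: Suzuki2025WeilHilbertSpace, (3.5) (TeX l.1019–1025), (3.8) (TeX l.1050–1058); erratum E21] -/
theorem screwPhatR_suzukiD_eq_tsum_screwBasis {ψ : ℝ → ℂ} (hψ : IsWeilTest ψ) {x : ℝ}
    (hx0 : x ≠ 0) (hE : lagariasE x ≠ 0)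
    (hxΓ : ∀ ρ ∈ ZetaZeros.riemannZetaNontrivialZeros, (x : ℂ) ≠ suzukiZeroParam ρ)
    (hxΓ' : ∀ ρ ∈ ZetaZeros.riemannZetaNontrivialZeros, -(x : ℂ) ≠ suzukiZeroParam ρ) :
    screwPhatR (suzukiD ψ) x = ∑' ρ : ZetaZeros.riemannZetaNontrivialZeros,
      (-((Real.sqrt (Real.pi * riemannZetaZeroOrder (ρ : ℂ)) : ℝ) : ℂ) *
        suzukiHat ψ (suzukiZeroParam (ρ : ℂ))) * screwBasis (ρ : ℂ) x := by
  rw [screwPhatR_suzukiD_eq_tsum hψ hx0 hE hxΓ hxΓ', ← tsum_mul_left]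
  refine tsum_congr fun ρ ↦ ?_
  have hm0 : (0 : ℝ) ≤ riemannZetaZeroOrder (ρ : ℂ) := ZetaZeroSum.zeroOrder_nonneg ρ
  have hmm := sqrt_pi_mul_mul_sqrt_div_pi hm0
  rw [screwBasis]
  -- `−(i/2)(1+Θ) · m ψ̂/(x−γ) = (−√(πm) ψ̂) · (√(m/π) · i(1+Θ)/(2(x−γ)))`
  have hx : (x : ℂ) - suzukiZeroParam (ρ : ℂ) ≠ 0 := sub_ne_zero.2 (hxΓ ρ ρ.2)
  rw [show ((riemannZetaZeroOrder (ρ : ℂ) : ℤ) : ℂ) = ((riemannZetaZeroOrder (ρ : ℂ) : ℝ) : ℂ) by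
    norm_cast, ← hmm]
  field_simp

/-! ## 0c. Under RH: `⟨ψ,ψ⟩_W = Σ_ρ m_ρ ‖ψ̂(γ_ρ)‖²` -/

/-- Under RH a non-trivial zero is `ρ = ½ + i·Im ρ`. [folklore] -/
private theorem eq_half_add_im_of_rh (hRH : RiemannHypothesis) {ρ : ℂ}
    (hρ : ρ ∈ ZetaZeros.riemannZetaNontrivialZeros) : ρ = 1 / 2 + (ρ.im : ℂ) * I := by
  have hre : ρ.re = 1 / 2 := by
    refine hRH ρ (ZetaZeros.riemannZetaNontrivialZeros.zeta_eq_zero hρ) ?_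
      (ZetaZeros.riemannZetaNontrivialZeros.ne_one hρ)
    rintro ⟨n, rfl⟩
    have h0 := ZetaZeros.riemannZetaNontrivialZeros.re_pos hρ
    have e : (-2 * ((n : ℂ) + 1)) = ((-2 * ((n : ℝ) + 1) : ℝ) : ℂ) := by push_cast; ring
    rw [e, Complex.ofReal_re] at h0
    have : (0 : ℝ) ≤ n := n.cast_nonneg
    linarith
  apply Complex.ext
  · simp [hre]
  · simp

/-- Under RH, `weilMellin ψ ρ = ψ̂(−γ_ρ)` has `‖weilMellin ψ ρ‖² = (ψ ⋆ ψ̃)^(ρ)` at every zero.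
[cite: Suzuki2025WeilHilbertSpace, (1.2) (TeX l.247–252) with the explicit formula] -/
private theorem weilMellin_conv_eq_norm_sq_of_rh (hRH : RiemannHypothesis) {ψ : ℝ → ℂ}
    (hψ : IsWeilTest ψ) (ρ : ZetaZeros.riemannZetaNontrivialZeros) :
    weilMellin (weilConv ψ (weilReflect ψ)) ρ =
      ((‖suzukiHat ψ (-suzukiZeroParam (ρ : ℂ))‖ ^ 2 : ℝ) : ℂ) := by
  have e := eq_half_add_im_of_rh hRH ρ.2
  rw [suzukiHat_neg_suzukiZeroParam]
  conv_lhs => rw [e]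
  conv_rhs => rw [e]
  exact weilMellin_weilConv_weilReflect_half hψ _

/-- **Under RH, `W(ψ) = ⟨ψ,ψ⟩_W = Σ_ρ m_ρ ‖ψ̂(γ_ρ)‖²`**, and the series converges: the explicit formula
for `ψ ⋆ ψ̃` (`explicit_formula_holds`; zero side absolutely convergent, `summable_norm_zeroSide`),
`(ψ ⋆ ψ̃)^(ρ) = ‖ψ^(ρ)‖²` on the critical line, the dictionary `ψ^(ρ) = ψ̂(−γ_ρ) = ψ̂(γ_{1−ρ})` and the
reflection `ρ ↦ 1 − ρ` (`m` invariant). RH-CONSEQUENCE (binder kept).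
[cite: Suzuki2025WeilHilbertSpace, (1.2) (TeX l.247–252) and proof of Thm 4.4 (TeX l.1290–1300: "= π Σ_γ m_γ|ψ̂(γ)|² = π⟨ψ,ψ⟩_W")] -/
theorem weilQuadratic_eq_tsum_norm_sq_suzukiHat (hRH : RiemannHypothesis) {ψ : ℝ → ℂ}
    (hψ : IsWeilTest ψ) :
    (Summable fun ρ : ZetaZeros.riemannZetaNontrivialZeros ↦
        (riemannZetaZeroOrder (ρ : ℂ) : ℝ) * ‖suzukiHat ψ (suzukiZeroParam (ρ : ℂ))‖ ^ 2) ∧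
      weilQuadratic ψ = ((∑' ρ : ZetaZeros.riemannZetaNontrivialZeros,
        (riemannZetaZeroOrder (ρ : ℂ) : ℝ) * ‖suzukiHat ψ (suzukiZeroParam (ρ : ℂ))‖ ^ 2 : ℝ) : ℂ) := by
  set k := weilConv ψ (weilReflect ψ) with hk_def
  have hk : IsWeilTest k := hψ.weilConv hψ.weilReflect
  have hsum := summable_norm_zeroSide hk
  have hWZ : weilFunctional k = ∑' ρ : ZetaZeros.riemannZetaNontrivialZeros,
      (riemannZetaZeroOrder (ρ : ℂ) : ℂ) * weilMellin k ρ :=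
    tendsto_nhds_unique (explicit_formula_holds hk) (hasWeilZeroSide_tsum hsum)
  -- the terms, before reflection: `m_ρ ‖ψ̂(−γ_ρ)‖²`
  set G : ZetaZeros.riemannZetaNontrivialZeros → ℝ := fun ρ ↦
    (riemannZetaZeroOrder (ρ : ℂ) : ℝ) * ‖suzukiHat ψ (-suzukiZeroParam (ρ : ℂ))‖ ^ 2 with hG
  have hterm : ∀ ρ : ZetaZeros.riemannZetaNontrivialZeros,
      (riemannZetaZeroOrder (ρ : ℂ) : ℂ) * weilMellin k ρ = ((G ρ : ℝ) : ℂ) := by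
    intro ρ
    rw [hk_def, weilMellin_conv_eq_norm_sq_of_rh hRH hψ ρ, hG]
    push_cast
    rfl
  have hG0 : ∀ ρ, 0 ≤ G ρ := fun ρ ↦
    mul_nonneg (ZetaZeroSum.zeroOrder_nonneg ρ) (by positivity)
  have hsumG : Summable G := hsum.congr fun ρ ↦ by
    rw [hterm, Complex.norm_real, Real.norm_eq_abs, abs_of_nonneg (hG0 ρ)]
  -- reflect `ρ ↦ 1 − ρ`: `−γ_ρ = γ_{1−ρ}`, `m_{1−ρ} = m_ρ`
  have hinv : Function.Involutive (fun ρ : ZetaZeros.riemannZetaNontrivialZeros ↦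
      (⟨1 - (ρ : ℂ), oneSub_mem ρ⟩ : ZetaZeros.riemannZetaNontrivialZeros)) := by
    intro ρ; ext; simp
  have hGe : ∀ ρ : ZetaZeros.riemannZetaNontrivialZeros, G (hinv.toPerm _ ρ) =
      (riemannZetaZeroOrder (ρ : ℂ) : ℝ) * ‖suzukiHat ψ (suzukiZeroParam (ρ : ℂ))‖ ^ 2 := by
    intro ρ
    simp only [hG, Function.Involutive.coe_toPerm]
    rw [suzukiZeroParam_one_sub, neg_neg]
    congr 2
    exact_mod_cast riemannZetaZeroOrder_one_sub_of_mem ρ.2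
  have hsum' : Summable fun ρ : ZetaZeros.riemannZetaNontrivialZeros ↦
      (riemannZetaZeroOrder (ρ : ℂ) : ℝ) * ‖suzukiHat ψ (suzukiZeroParam (ρ : ℂ))‖ ^ 2 :=
    ((Equiv.summable_iff (hinv.toPerm _)).2 hsumG).congr hGe
  refine ⟨hsum', ?_⟩
  have htsum : ∑' ρ : ZetaZeros.riemannZetaNontrivialZeros,
      (riemannZetaZeroOrder (ρ : ℂ) : ℝ) * ‖suzukiHat ψ (suzukiZeroParam (ρ : ℂ))‖ ^ 2 =
      ∑' ρ : ZetaZeros.riemannZetaNontrivialZeros, G ρ := by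
    rw [← Equiv.tsum_eq (hinv.toPerm _) G]
    exact tsum_congr fun ρ ↦ (hGe ρ).symm
  show weilFunctional (weilConv ψ (weilReflect ψ)) = _
  rw [← hk_def, hWZ, htsum, Complex.ofReal_tsum]
  exact tsum_congr hterm

namespace ScrewLineRepairedThm14

/-! ## A. Two generic lemmas: orthonormal ℓ²-sums, and `L²`-sums versus pointwise sums -/

/-- An orthonormal family with square-summable coefficients is summable in the Hilbert space and
`‖Σ c_i v_i‖² = Σ |c_i|²` (Parseval for an orthonormal FAMILY). [folklore] -/
private theorem summable_and_norm_sq_tsum {ι E : Type*} [NormedAddCommGroup E] [InnerProductSpace ℂ E]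
    [CompleteSpace E] {v : ι → E} (hv : Orthonormal ℂ v) {c : ι → ℂ}
    (hc : Summable fun i ↦ ‖c i‖ ^ 2) :
    Summable (fun i ↦ c i • v i) ∧ ‖∑' i, c i • v i‖ ^ 2 = ∑' i, ‖c i‖ ^ 2 := by
  classical
  have hV := hv.orthogonalFamily
  have hs : Summable fun i ↦ c i • v i := by
    have h := (hV.summable_iff_norm_sq_summable c).2 hc
    simpa [LinearIsometry.toSpanSingleton_apply] using h
  refine ⟨hs, ?_⟩
  have h1 : Tendsto (fun s : Finset ι ↦ ‖∑ i ∈ s, c i • v i‖ ^ 2) atTop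
      (𝓝 (‖∑' i, c i • v i‖ ^ 2)) :=
    ((continuous_norm.pow 2).tendsto _).comp hs.hasSum
  have h2 : Tendsto (fun s : Finset ι ↦ ∑ i ∈ s, ‖c i‖ ^ 2) atTop (𝓝 (∑' i, ‖c i‖ ^ 2)) :=
    hc.hasSum
  have heq : (fun s : Finset ι ↦ ‖∑ i ∈ s, c i • v i‖ ^ 2) = fun s ↦ ∑ i ∈ s, ‖c i‖ ^ 2 := by
    funext s
    have h := hV.norm_sum c s
    simpa [LinearIsometry.toSpanSingleton_apply] using h
  rw [heq] at h1
  exact tendsto_nhds_unique h1 h2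

/-- The class of a finite sum of `L²` functions is the finite sum of the classes, pointwise a.e.
[folklore] -/
private theorem coeFn_finset_sum_toLp {ι : Type*} (s : Finset ι) {f : ι → ℝ → ℂ}
    (hf : ∀ i, MemLp (f i) 2 (volume : Measure ℝ)) (c : ι → ℂ) :
    ((∑ i ∈ s, c i • ((hf i).toLp (f i) : Lp ℂ 2 (volume : Measure ℝ)) : Lp ℂ 2 volume) : ℝ → ℂ)
      =ᵐ[volume] fun x ↦ ∑ i ∈ s, c i * f i x := by
  classical
  induction s using Finset.induction_on with
  | empty =>
    filter_upwards [Lp.coeFn_zero ℂ 2 (volume : Measure ℝ)] with x hx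
    simp only [Finset.sum_empty] at hx ⊢
    exact hx
  | @insert a s ha ih =>
    rw [Finset.sum_insert ha]
    filter_upwards [ih, Lp.coeFn_add (c a • ((hf a).toLp (f a) : Lp ℂ 2 volume))
      (∑ i ∈ s, c i • ((hf i).toLp (f i) : Lp ℂ 2 volume)),
      Lp.coeFn_smul (c a) ((hf a).toLp (f a) : Lp ℂ 2 volume), (hf a).coeFn_toLp] with x hx hadd hsm hfa
    rw [hadd, Pi.add_apply, hsm, Pi.smul_apply, hfa, hx, Finset.sum_insert ha, smul_eq_mul]

/-- **An `L²`-convergent series of `L²` functions that also converges pointwise a.e. has the pointwise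
sum as (a representative of) its `L²` sum.** (Countable index; a subsequence of the partial sums along
an exhausting sequence of finite sets converges a.e.) [folklore] -/
private theorem coeFn_tsum_ae_eq_tsum {ι : Type*} [Countable ι] {f : ι → ℝ → ℂ}
    (hf : ∀ i, MemLp (f i) 2 (volume : Measure ℝ)) {c : ι → ℂ}
    (hs : Summable fun i ↦ c i • ((hf i).toLp (f i) : Lp ℂ 2 (volume : Measure ℝ)))
    (hpt : ∀ᵐ x : ℝ, Summable fun i ↦ c i * f i x) :
    ((∑' i, c i • ((hf i).toLp (f i) : Lp ℂ 2 (volume : Measure ℝ)) : Lp ℂ 2 volume) : ℝ → ℂ)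
      =ᵐ[volume] fun x ↦ ∑' i, c i * f i x := by
  classical
  set G : Lp ℂ 2 (volume : Measure ℝ) := ∑' i, c i • ((hf i).toLp (f i) : Lp ℂ 2 volume) with hG
  -- partial sums converge to `G` in `L²`, hence in measure, hence a.e. along a subsequence
  have hT : Tendsto (fun s : Finset ι ↦ ∑ i ∈ s, c i • ((hf i).toLp (f i) : Lp ℂ 2 volume))
      atTop (𝓝 G) := hs.hasSum
  have hM := tendstoInMeasure_of_tendsto_Lp hT
  haveI : (atTop : Filter (Finset ι)).NeBot := atTop_neBot
  obtain ⟨ns, hns, hae⟩ := hM.exists_seq_tendsto_ae'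
  -- representatives of the partial sums
  have hrep : ∀ᵐ x : ℝ, ∀ n : ℕ,
      ((∑ i ∈ ns n, c i • ((hf i).toLp (f i) : Lp ℂ 2 volume) : Lp ℂ 2 volume) : ℝ → ℂ) x =
        ∑ i ∈ ns n, c i * f i x := by
    rw [ae_all_iff]
    intro n
    exact coeFn_finset_sum_toLp (ns n) hf c
  filter_upwards [hae, hrep, hpt] with x hx hxrep hxpt
  -- along the subsequence the pointwise partial sums converge to the pointwise `tsum`
  have h1 : Tendsto (fun n : ℕ ↦ ∑ i ∈ ns n, c i * f i x) atTop (𝓝 (∑' i, c i * f i x)) :=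
    hxpt.hasSum.comp hns
  have h2 : Tendsto (fun n : ℕ ↦ ∑ i ∈ ns n, c i * f i x) atTop (𝓝 ((G : ℝ → ℂ) x)) := by
    refine hx.congr fun n ↦ ?_
    exact hxrep n
  exact tendsto_nhds_unique h2 h1

/-- `‖F‖² = ∫ ‖F(ξ)‖² dξ` for a class `F ∈ L²(ℝ)`. [folklore] -/
private theorem norm_sq_eq_integral_norm_sq (F : Lp ℂ 2 (volume : Measure ℝ)) :
    ‖F‖ ^ 2 = ∫ ξ : ℝ, ‖(F : ℝ → ℂ) ξ‖ ^ 2 := by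
  have h1 : inner ℂ F F = ((‖F‖ ^ 2 : ℝ) : ℂ) := by
    rw [inner_self_eq_norm_sq_to_K]; norm_cast
  have h2 : inner ℂ F F = ((∫ ξ : ℝ, ‖(F : ℝ → ℂ) ξ‖ ^ 2 : ℝ) : ℂ) := by
    rw [L2.inner_def, ← integral_complex_ofReal]
    refine integral_congr_ae (ae_of_all _ fun ξ ↦ ?_)
    beta_reduce
    rw [inner_self_eq_norm_sq_to_K]
    norm_cast
  exact_mod_cast Complex.ofReal_injective (h1.symm.trans h2)

/-! ## B. Summability of the (3.8)ᴿ series at every good real point -/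

/-- `Σ_ρ m_ρ ‖ψ̂(γ_ρ)‖ < ∞` for a test function (the zero side of the explicit formula converges
absolutely, `summable_norm_zeroSide`, transported by `ψ̂(γ_ρ) = weilMellin ψ (1 − ρ)`). RH-FREE.
[cite: Suzuki2025WeilHilbertSpace, (1.2) (TeX l.247–252: absolute convergence of ⟨ψ₁,ψ₂⟩_W)] -/
theorem summable_zeroOrder_mul_norm_suzukiHat {ψ : ℝ → ℂ} (hψ : IsWeilTest ψ) :
    Summable fun ρ : ZetaZeros.riemannZetaNontrivialZeros ↦
      (riemannZetaZeroOrder (ρ : ℂ) : ℝ) * ‖suzukiHat ψ (suzukiZeroParam (ρ : ℂ))‖ := by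
  have h := summable_norm_zeroSide hψ
  have hinv : Function.Involutive (fun ρ : ZetaZeros.riemannZetaNontrivialZeros ↦
      (⟨1 - (ρ : ℂ), oneSub_mem ρ⟩ : ZetaZeros.riemannZetaNontrivialZeros)) := by
    intro ρ; ext; simp
  have h' := (Equiv.summable_iff (hinv.toPerm _)).2 h
  refine h'.congr fun ρ ↦ ?_
  simp only [Function.comp_apply, Function.Involutive.coe_toPerm]
  have hm0 : (0 : ℝ) ≤ riemannZetaZeroOrder (ρ : ℂ) := ZetaZeroSum.zeroOrder_nonneg ρ
  rw [norm_mul, ← suzukiHat_neg_suzukiZeroParam, suzukiZeroParam_one_sub, neg_neg,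
    show ((riemannZetaZeroOrder (1 - (ρ : ℂ)) : ℤ) : ℂ) = ((riemannZetaZeroOrder (ρ : ℂ) : ℝ) : ℂ) by
      rw [riemannZetaZeroOrder_one_sub_of_mem ρ.2]; norm_cast,
    Complex.norm_real, Real.norm_eq_abs, abs_of_nonneg hm0]

/-- The (3.8)ᴿ series `Σ_ρ (−√(πm_ρ)ψ̂(γ_ρ))·F_ρ(x)` converges absolutely at every real `x`
(`|F_ρ(x)| ≤ √(m_ρ/π)|1+Θ(x)|/2` once `|x − γ_ρ| ≥ 1`, and `√(πm)√(m/π) = m`). RH-FREE.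
[cite: Suzuki2025WeilHilbertSpace, (3.8) (TeX l.1050–1058)] -/
theorem summable_coeff_mul_screwBasis {ψ : ℝ → ℂ} (hψ : IsWeilTest ψ) (x : ℝ) :
    Summable fun ρ : ZetaZeros.riemannZetaNontrivialZeros ↦
      (-((Real.sqrt (Real.pi * riemannZetaZeroOrder (ρ : ℂ)) : ℝ) : ℂ) *
        suzukiHat ψ (suzukiZeroParam (ρ : ℂ))) * screwBasis (ρ : ℂ) x := by
  have hS := (summable_zeroOrder_mul_norm_suzukiHat hψ).mul_left (‖1 + lagariasTheta (x : ℂ)‖ / 2)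
  refine Summable.of_norm_bounded_eventually hS ?_
  filter_upwards [(weilZeroFinset (|x| + 1)).eventually_cofinite_notMem] with ρ hρ
  rw [mem_weilZeroFinset, not_le] at hρ
  have hm0 : (0 : ℝ) ≤ riemannZetaZeroOrder (ρ : ℂ) := ZetaZeroSum.zeroOrder_nonneg ρ
  -- `|x − γ_ρ| ≥ 1`
  have hdist : 1 ≤ ‖(x : ℂ) - suzukiZeroParam (ρ : ℂ)‖ := by
    have h1 := abs_im_le_norm_zeroParam (ρ : ℂ)
    have h2 := norm_sub_norm_le (suzukiZeroParam (ρ : ℂ)) (x : ℂ)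
    rw [norm_sub_rev, Complex.norm_real, Real.norm_eq_abs] at h2
    linarith
  rw [screwBasis, norm_mul, norm_mul, norm_mul, norm_neg, Complex.norm_real, Complex.norm_real,
    norm_div, norm_mul, Complex.norm_I, one_mul, norm_mul, Complex.norm_two,
    Real.norm_of_nonneg (Real.sqrt_nonneg _), Real.norm_of_nonneg (Real.sqrt_nonneg _)]
  have hsq : Real.sqrt (Real.pi * riemannZetaZeroOrder (ρ : ℂ)) *
      Real.sqrt ((riemannZetaZeroOrder (ρ : ℂ) : ℝ) / Real.pi) = riemannZetaZeroOrder (ρ : ℂ) := by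
    rw [← Real.sqrt_mul (by positivity), show Real.pi * (riemannZetaZeroOrder (ρ : ℂ) : ℝ) *
      ((riemannZetaZeroOrder (ρ : ℂ) : ℝ) / Real.pi) = (riemannZetaZeroOrder (ρ : ℂ) : ℝ) *
      riemannZetaZeroOrder (ρ : ℂ) by field_simp, Real.sqrt_mul_self hm0]
  have hpos : 0 < 2 * ‖(x : ℂ) - suzukiZeroParam (ρ : ℂ)‖ := by linarith
  calc Real.sqrt (Real.pi * riemannZetaZeroOrder (ρ : ℂ)) * ‖suzukiHat ψ (suzukiZeroParam (ρ : ℂ))‖ *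
        (Real.sqrt ((riemannZetaZeroOrder (ρ : ℂ) : ℝ) / Real.pi) *
          (‖1 + lagariasTheta (x : ℂ)‖ / (2 * ‖(x : ℂ) - suzukiZeroParam (ρ : ℂ)‖)))
      = ‖1 + lagariasTheta (x : ℂ)‖ / (2 * ‖(x : ℂ) - suzukiZeroParam (ρ : ℂ)‖) *
          ((riemannZetaZeroOrder (ρ : ℂ) : ℝ) * ‖suzukiHat ψ (suzukiZeroParam (ρ : ℂ))‖) := by
        rw [show Real.sqrt (Real.pi * riemannZetaZeroOrder (ρ : ℂ)) *
            ‖suzukiHat ψ (suzukiZeroParam (ρ : ℂ))‖ *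
            (Real.sqrt ((riemannZetaZeroOrder (ρ : ℂ) : ℝ) / Real.pi) *
              (‖1 + lagariasTheta (x : ℂ)‖ / (2 * ‖(x : ℂ) - suzukiZeroParam (ρ : ℂ)‖))) =
            (Real.sqrt (Real.pi * riemannZetaZeroOrder (ρ : ℂ)) *
              Real.sqrt ((riemannZetaZeroOrder (ρ : ℂ) : ℝ) / Real.pi)) *
            ‖suzukiHat ψ (suzukiZeroParam (ρ : ℂ))‖ *
            (‖1 + lagariasTheta (x : ℂ)‖ / (2 * ‖(x : ℂ) - suzukiZeroParam (ρ : ℂ)‖)) by ring, hsq]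
        ring
    _ ≤ ‖1 + lagariasTheta (x : ℂ)‖ / 2 *
          ((riemannZetaZeroOrder (ρ : ℂ) : ℝ) * ‖suzukiHat ψ (suzukiZeroParam (ρ : ℂ))‖) := by
        apply mul_le_mul_of_nonneg_right _ (mul_nonneg hm0 (norm_nonneg _))
        apply div_le_div_of_nonneg_left (norm_nonneg _) two_pos
        linarith

end ScrewLineRepairedThm14

open ScrewLineRepairedThm14

/-! ## C. RH ⟹ (1.9)ᴿ, and the discharges -/

/-- **RH ⟹ (1.9)ᴿ: under RH, `‖P̂ᴿ_{Dψ}‖²_{L²(ℝ)} = π⟨ψ,ψ⟩_W` for every `ψ ∈ C_c^∞(ℝ)`** — the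
RH-consequence half of CJM Thm 1.4 over the repaired screw line, by the printed argument ((3.8) +
Prop 4.1 + (1.2)). RH-CONSEQUENCE (binder explicit).
[cite: Suzuki2025WeilHilbertSpace, Thm 1.4 (TeX l.420–430), proof §4.3 (TeX l.1286–1300); erratum E21] -/
theorem Suzuki2025_thm14R_onlyIf (hRH : RiemannHypothesis) {ψ : ℝ → ℂ} (hψ : IsWeilTest ψ) :
    ((∫ x : ℝ, ‖screwPhatR (suzukiD ψ) x‖ ^ 2 : ℝ) : ℂ) = Real.pi * weilQuadratic ψ := by
  classical
  obtain ⟨⟨hF, hON, -⟩, -, -⟩ := Suzuki2025_prop41_holds hRH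
  obtain ⟨hsumW, hW⟩ := weilQuadratic_eq_tsum_norm_sq_suzukiHat hRH hψ
  -- coefficients
  set c : ZetaZeros.riemannZetaNontrivialZeros → ℂ := fun ρ ↦
    -((Real.sqrt (Real.pi * riemannZetaZeroOrder (ρ : ℂ)) : ℝ) : ℂ) *
      suzukiHat ψ (suzukiZeroParam (ρ : ℂ)) with hc
  have hc2 : ∀ ρ : ZetaZeros.riemannZetaNontrivialZeros, ‖c ρ‖ ^ 2 =
      Real.pi * ((riemannZetaZeroOrder (ρ : ℂ) : ℝ) * ‖suzukiHat ψ (suzukiZeroParam (ρ : ℂ))‖ ^ 2) := by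
    intro ρ
    have hm0 : (0 : ℝ) ≤ riemannZetaZeroOrder (ρ : ℂ) := ZetaZeroSum.zeroOrder_nonneg ρ
    simp only [hc, norm_mul, norm_neg, Complex.norm_real, Real.norm_of_nonneg (Real.sqrt_nonneg _)]
    rw [mul_pow, Real.sq_sqrt (by positivity)]
    ring
  have hcsum : Summable fun ρ ↦ ‖c ρ‖ ^ 2 := (hsumW.mul_left Real.pi).congr fun ρ ↦ (hc2 ρ).symm
  -- the `L²` sum of `c_ρ F_ρ`
  obtain ⟨hsG, hnormG⟩ := summable_and_norm_sq_tsum hON hcsum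
  set G : Lp ℂ 2 (volume : Measure ℝ) :=
    ∑' ρ, c ρ • ((hF ρ).toLp _ : Lp ℂ 2 (volume : Measure ℝ)) with hG
  -- it is `P̂ᴿ_{Dψ}` a.e.
  have hGae : (G : ℝ → ℂ) =ᵐ[volume] fun x ↦ screwPhatR (suzukiD ψ) x := by
    have h1 := coeFn_tsum_ae_eq_tsum hF hsG (ae_of_all _ fun x ↦ summable_coeff_mul_screwBasis hψ x)
    filter_upwards [h1, ae_good_point] with x hx ⟨hx0, hE, hxΓ, hxΓ'⟩
    rw [hx, screwPhatR_suzukiD_eq_tsum_screwBasis hψ hx0 hE hxΓ hxΓ']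
  -- norms
  have hint : ∫ x : ℝ, ‖screwPhatR (suzukiD ψ) x‖ ^ 2 = ‖G‖ ^ 2 := by
    rw [norm_sq_eq_integral_norm_sq]
    refine integral_congr_ae ?_
    filter_upwards [hGae] with x hx
    rw [hx]
  have htsum : ∑' ρ, ‖c ρ‖ ^ 2 = Real.pi * ∑' ρ : ZetaZeros.riemannZetaNontrivialZeros,
      (riemannZetaZeroOrder (ρ : ℂ) : ℝ) * ‖suzukiHat ψ (suzukiZeroParam (ρ : ℂ))‖ ^ 2 := by
    rw [← tsum_mul_left]
    exact tsum_congr hc2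
  rw [hint, hG, hnormG, htsum, hW]
  push_cast
  ring

/-- **CJM Thm 1.4 over the repaired screw line — PROVED as an RH-equivalence:**
`RiemannHypothesis ↔ ∀ ψ ∈ C_c^∞(ℝ), ‖P̂ᴿ_{Dψ}‖² = π⟨ψ,ψ⟩_W` (`⟸` = Weil's criterion,
`Suzuki2025_thm14R_if`; `⟹` = `Suzuki2025_thm14R_onlyIf`). E-class equivalence (COLUMN 6 DBR).
[cite: Suzuki2025WeilHilbertSpace, Thm 1.4 (TeX l.420–430), proof §4.3 (TeX l.1286–1345); erratum E21] -/
theorem Suzuki2025_thm14R_holds : Suzuki2025_thm14R :=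
  ⟨fun hRH _ hψ ↦ Suzuki2025_thm14R_onlyIf hRH hψ, Suzuki2025_thm14R_if⟩

/-- **CJM Cor 1.5 over the repaired screw line — PROVED as an RH-equivalence** (≡ Thm 1.4ᴿ in the
kernel, `Suzuki2025_cor15R_of_thm14R`). [cite: Suzuki2025WeilHilbertSpace, Cor 1.5 (TeX l.438–451), proof §4.3 (TeX l.1352–1380); erratum E21] -/
theorem Suzuki2025_cor15R_holds : Suzuki2025_cor15R :=
  Suzuki2025_cor15R_of_thm14R Suzuki2025_thm14R_holds

end Literature.NumberTheory.LFunctions
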